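import Mathlib
import HarnessLib
import Summits.KontsevichZagierPeriods.Zeta5Search.CatalanTwoAdicRayBound
import Summits.KontsevichZagierPeriods.Zeta5Search.CatalanTwoAdicPF
import Summits.KontsevichZagierPeriods.Zeta5Search.CatalanTwoAdicQxi
import Summits.KontsevichZagierPeriods.Zeta5Search.Denom.CatalanRayPClosedInt

/-!
# The 2-adic ray chain on fam-denom's closed form — the endgame, modulo ONE named finite input

HONEST FRAMING: systematic search; no irrationality claim unless certified.  The constant concerned is the
2-adic number `ξ = CatalanTwoAdicSeries.xi` (numerically Calegari's 2-adic Catalan constant `ζ₂(2)`, whose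
irrationality is KNOWN — Calegari 2005; that identification is not in the kernel).  Nothing here concerns the
irrationality of Catalan's real constant `G`.

fam-catalan (pub-zeta5), `families/catalan/TWOADIC.md` §12.  This file instantiates the INTRINSIC ray chain
(`CatalanTwoAdicRay.ray_measure_intrinsic`: ANY rational sequence `P_n` with (a) the 2-adic identity
`J₂ = P_n + ξ Q_n`, (b) integrality of `Λ_n P_n`, (c) summed growth `e^{(h+ε)n}` with `h < 4W log 2`, `W = 2j+1`) at

  `P_n := rayPClosed j n`  (fam-denom's explicit closed form, `Denom/CatalanRayPClosed`),

and discharges / names each input: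

* (a) ⇐ `RayPF j` (the partial-fraction identity `PF n (jn)` of `CatalanTwoAdicPF` for every `n ≥ 1`) together with
  `RayQxi j` (the slid `G`-coefficient `QxiClosed n (jn)` is the tree's `catalanQ`), and `RayQxi j` IS A THEOREM for
  every `j ≥ 1`: `rayQxi_holds` (`CatalanTwoAdicQxi.qxiSum_ray_eq_catalanQ`, a termwise factorial identity); so
  (a) ⇐ `RayPF j` alone: `ray_identity_closed`;
* (b) is a THEOREM for `j ≥ 4`: fam-denom's `rayPClosed_isInt` (`Denom/CatalanRayPClosedInt`, Theorem K6) — the two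
  families' multipliers agree definitionally (`ray_integrality_closed`);
* (c) ⇐ `RayPGrowthAt j b`: `|rayPClosed j n| ≤ e^{(b+ε)n}` eventually, with the RATE `b` A PARAMETER (fam-denom's
  re-plumbing ask, INBOX 01:30Z): the chain closes whenever `b_j ≤ b` and `h(j,b) = b + W(1 + 2 log 2) < 4W log 2`
  (`ray_sum_growth`, from the tree-bound `ray_growth` of `Λ_n Q_n` and `rayMult_eventually_le_exp`).  At the TRUE
  rate `b = b_j` the hypothesis is not provable termwise (the γ-pole coefficients of the closed form are individually
  larger); at `b = b_{j+1}` it is fam-denom's KERNEL THEOREM `abs_rayPClosed_eventually_le_exp` (staged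
  `Denom/CatalanRayPGrowth`), and `growthRate_succ_lt : h(j, b_{j+1}) < 4W log 2` for every `j ≥ 3` (`bRate_le_succ`,
  convexity of `x log x`, supplies `b_j ≤ b_{j+1}`).

Main statements: `xi_not_ratCast_at`, `ray_measure_at` (rate-parametric); `xi_not_ratCast_succRate :
4 ≤ j → RayPF j → RayPGrowthAt j (bRate (j+1)) → ∀ r : ℚ, ξ ≠ r` and `ray_measure_succRate` (exponent
exponent `τ'/(τ − h(j, b_{j+1}))`).  So, once fam-denom's growth file is in the tree, an UNCONDITIONAL kernel
irrationality measure for `ξ` from the Catalan box needs exactly ONE input: `RayPF j` for one `j ≥ 4` — a family of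
identities of rational functions (exact-arithmetic prechecks: `families/catalan/lean/pf_check.py`, 0 mismatches),
whose first term on the first admissible ray holds in the kernel (`PF_one_four`, giving the UNCONDITIONAL instance
`J2_ray_four_one`; `CatalanTwoAdicPF.J2_ray_three_one` on ray 3).
-/

noncomputable section

namespace Summit.KontsevichZagierPeriods.Zeta5Search.CatalanTwoAdicSeries

open Real Filter Finset Asymptotics
open Summit.KontsevichZagierPeriods.Zeta5Search.CatalanQSum (catalanQ)
open Summit.KontsevichZagierPeriods.Zeta5Search.Denom.CatalanRayPClosed
  (K0 Nnum coef logDer D1 D2 skip PClosed rayPClosed rayPClosed_isInt)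

/-! ### The named inputs on a ray -/

/-- NODE (L2): the partial-fraction identity `PF n (jn)` (`CatalanTwoAdicPF.PF`) for every `n ≥ 1` on the ray `j`.
An identity of rational functions of `ν` for each `n`; exact-checked for small `(n, j)`; `PF_one_three`,
`PF_one_four` are kernel instances. -/
@[conjecture] def RayPF (j : ℕ) : Prop :=
  ∀ n : ℕ, 1 ≤ n → PF n (j * n)

/-- (L4): on the ray, the `ξ`-coefficient of the slid series, `QxiClosed n (jn)`, is the tree's closed form
`catalanQ n (jn) n ((j+1)n) n`.  A THEOREM for every `j ≥ 1` (`rayQxi_holds`, from `CatalanTwoAdicQxi`); kept as a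
named statement because it is input (a)'s second half. -/
def RayQxi (j : ℕ) : Prop :=
  ∀ n : ℕ, 1 ≤ n → QxiClosed n (j * n) = catalanQ n (j * n) n ((j + 1) * n) n

/-- **(L4) holds on every ray** `j ≥ 1` (`CatalanTwoAdicQxi.qxiSum_ray_eq_catalanQ`: a termwise factorial identity
between the slid coefficient sum and `Denom.CatalanBox.QClosed`, then `catalanQ_eq_QClosed`). -/
theorem rayQxi_holds (j : ℕ) (hj : 1 ≤ j) : RayQxi j := by
  intro n _
  unfold QxiClosed
  exact qxiSum_ray_eq_catalanQ j n hj

/-- NODE (T-G at rate `b`): `|rayPClosed j n| ≤ e^{(b + ε) n}` for all large `n`, for every `ε > 0`.  TRUE at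
`b = b_j = bRate j` (`|P_n| ∼ G·|Q_n|`, but that is visible only through the real period `Jsym`), and a KERNEL
THEOREM of fam-denom at `b = b_{j+1}` (`Denom.CatalanRayPClosed.abs_rayPClosed_eventually_le_exp`, termwise on the
closed form; the γ-pole coefficients are individually LARGER than `e^{b_j n}` — fam-denom INBOX 01:30Z — so `b_j`
is not reachable termwise, and the endgame below carries the rate as a parameter). -/
@[conjecture] def RayPGrowthAt (j : ℕ) (b : ℝ) : Prop :=
  ∀ ε : ℝ, 0 < ε → ∃ n₀ : ℕ, ∀ n : ℕ, n₀ ≤ n → |((rayPClosed j n : ℚ) : ℝ)| ≤ exp ((b + ε) * n)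

/-- The combined growth rate `h(j, b) = b + W(1 + 2 log 2)` of `Λ_n · max(|Q_n|, |P_n|)`, `W = 2j+1`
(`h(j, b_j) = rayRate j`). -/
def growthRate (j : ℕ) (b : ℝ) : ℝ := b + (2 * j + 1) * (1 + 2 * log 2)

/-- `h(j, b_j) = h_j`. -/
theorem growthRate_bRate (j : ℕ) : growthRate j (bRate j) = rayRate j := rfl

/-- `b_j ≤ b_{j+1}` (convexity of `x log x`: `b_j = f(j+1) − f(j)`, `f(x) = x log x`). -/
theorem bRate_le_succ (j : ℕ) : bRate j ≤ bRate (j + 1) := by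
  have h := convexOn_mul_log.slope_mono_adjacent (x := (j : ℝ)) (y := (j : ℝ) + 1) (z := (j : ℝ) + 2)
    (Set.mem_Ici.mpr (by positivity)) (Set.mem_Ici.mpr (by positivity)) (by linarith) (by linarith)
  have e1 : ((j : ℝ) + 1 - j) = 1 := by ring
  have e2 : ((j : ℝ) + 2 - (j + 1)) = 1 := by ring
  rw [e1, e2, div_one, div_one] at h
  unfold bRate
  push_cast
  rw [show (j : ℝ) + 1 + 1 = j + 2 by ring]
  linarith

/-- **The criterion inequality at the kernel rate `b_{j+1}`**: `h(j, b_{j+1}) < 4(2j+1) log 2` for every `j ≥ 3`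
(`b_{j+1} < W(2 log 2 − 1)`: `j = 3`: 2.502 < 2.704; `j = 4`: 2.703 < 3.477; from `bRate_le`: `b_{j+1} ≤ log(j+2) + 1`
and `log(j+2) ≤ 2 log 2 + (j+2)/4 − 1`, it reduces to `log 2 > (9j+6)/(16j)`, true from `j = 3` on). -/
theorem growthRate_succ_lt (j : ℕ) (hj : 3 ≤ j) : growthRate j (bRate (j + 1)) < 4 * (2 * j + 1) * log 2 := by
  have hj3 : (3 : ℝ) ≤ j := by exact_mod_cast hj
  have hb := bRate_le (j + 1) (by omega)
  push_cast at hb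
  have hl2 : (0.6931471803 : ℝ) < log 2 := Real.log_two_gt_d9
  have h4 : log ((j : ℝ) + 1 + 1) ≤ 2 * log 2 + (((j : ℝ) + 2) / 4 - 1) := by
    have hq : log (((j : ℝ) + 2) / 4) ≤ ((j : ℝ) + 2) / 4 - 1 := Real.log_le_sub_one_of_pos (by positivity)
    rw [Real.log_div (by positivity) (by norm_num), show (4 : ℝ) = 2 ^ 2 by norm_num, Real.log_pow] at hq
    push_cast at hq
    rw [show (j : ℝ) + 1 + 1 = j + 2 by ring]
    linarith
  unfold growthRate
  nlinarith

/-! ### Discharging the inputs of the intrinsic chain -/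

/-- Input (a): the 2-adic identity on the ray with `P_n := rayPClosed j n`, from (L2) (and the theorem (L4)). -/
theorem ray_identity_closed {j : ℕ} (hj : 1 ≤ j) (hPF : RayPF j) (n : ℕ) (hn : 1 ≤ n) :
    J2 n (j * n) n ((j + 1) * n) n
      = ((rayPClosed j n : ℚ) : ℚ_[2]) + xi * ((rayQ j n : ℚ) : ℚ_[2]) :=
  J2_ray_eq_of_PF j n (hPF n hn) (rayQxi_holds j hj n hn)

/-- Input (b) is a THEOREM for `j ≥ 4`: `Λ_n · rayPClosed j n ∈ ℤ` (fam-denom's `rayPClosed_isInt`; the multiplier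
`rayMult j n = d*_{(j+1)n} d*_{jn} 2^{2(2j+1)n}` is the same expression in both families' files). -/
theorem ray_integrality_closed {j : ℕ} (hj : 4 ≤ j) (n : ℕ) (hn : 1 ≤ n) :
    ∃ z : ℤ, (z : ℚ) = rayMult j n * rayPClosed j n := by
  obtain ⟨z, hz⟩ := rayPClosed_isInt j n hj hn
  exact ⟨z, by rw [hz]; rfl⟩

/-- (T-G at rate `b ≥ b_j`) gives the summed growth hypothesis of `ray_measure_intrinsic` at rate `h(j, b) + ε`:
`|Λ_n Q_n| + |Λ_n P_n| ≤ e^{(h(j,b) + ε) n}` for large `n` (`ray_growth` for the `Q`-part, `rayMult_eventually_le_exp`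
times the `P`-envelope for the `P`-part, and `2 ≤ e^{(ε/2) n}`). -/
theorem ray_sum_growth {j : ℕ} (hj : 1 ≤ j) {b : ℝ} (hb : bRate j ≤ b) (hB : RayPGrowthAt j b) {ε : ℝ}
    (hε : 0 < ε) : ∃ n₀ : ℕ, ∀ n : ℕ, n₀ ≤ n →
      ((|rayMult j n * rayQ j n| + |rayMult j n * rayPClosed j n| : ℚ) : ℝ) ≤ exp ((growthRate j b + ε) * n) := by
  have hg : rayRate j ≤ growthRate j b := by unfold rayRate growthRate; linarith
  obtain ⟨n₀, hQ, -⟩ := ray_growth j hj (half_pos hε)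
  have h4 : 0 < ε / 4 := by positivity
  obtain ⟨m₀, hP⟩ := hB (ε / 4) h4
  obtain ⟨k₀, hΛ⟩ := eventually_atTop.mp (rayMult_eventually_le_exp j h4)
  obtain ⟨N, hN⟩ := exists_nat_ge (2 / ε)
  refine ⟨max (max (max n₀ m₀) k₀) N, fun n hn => ?_⟩
  have hn0 : n₀ ≤ n := le_trans (le_trans (le_trans (le_max_left _ _) (le_max_left _ _)) (le_max_left _ _)) hn
  have hm0 : m₀ ≤ n := le_trans (le_trans (le_trans (le_max_right _ _) (le_max_left _ _)) (le_max_left _ _)) hn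
  have hk0 : k₀ ≤ n := le_trans (le_trans (le_max_right _ _) (le_max_left _ _)) hn
  have hN' : (2 / ε : ℝ) ≤ n := hN.trans (by exact_mod_cast le_trans (le_max_right _ _) hn)
  have hQn := hQ n hn0
  have hPn := hP n hm0
  have hΛn := hΛ n hk0
  have hΛ0 : (0 : ℝ) ≤ ((rayMult j n : ℚ) : ℝ) := by exact_mod_cast rayMult_nonneg j n
  have hx : (0 : ℝ) ≤ n := by positivity
  have htwo : (2 : ℝ) ≤ exp (ε / 2 * n) := by
    have h := Real.add_one_le_exp (ε / 2 * n)
    have : (1 : ℝ) ≤ ε / 2 * n := by have := (div_le_iff₀ hε).mp hN'; linarith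
    linarith
  have hQ' : |((rayMult j n : ℚ) : ℝ) * ((rayQ j n : ℚ) : ℝ)| ≤ exp ((growthRate j b + ε / 2) * n) :=
    hQn.trans (exp_le_exp.mpr (by nlinarith))
  have hP' : |((rayMult j n : ℚ) : ℝ) * ((rayPClosed j n : ℚ) : ℝ)| ≤ exp ((growthRate j b + ε / 2) * n) := by
    rw [abs_mul, abs_of_nonneg hΛ0]
    calc ((rayMult j n : ℚ) : ℝ) * |((rayPClosed j n : ℚ) : ℝ)|
        ≤ exp (((2 * j + 1) * (1 + 2 * log 2) + ε / 4) * n) * exp ((b + ε / 4) * n) :=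
          mul_le_mul hΛn hPn (abs_nonneg _) (exp_pos _).le
      _ = exp ((growthRate j b + ε / 2) * n) := by rw [← exp_add]; unfold growthRate; ring_nf
  have hsplit : exp ((growthRate j b + ε) * n) = exp ((growthRate j b + ε / 2) * n) * exp (ε / 2 * n) := by
    rw [← exp_add]; ring_nf
  push_cast
  rw [hsplit]
  calc |((rayMult j n : ℚ) : ℝ) * ((rayQ j n : ℚ) : ℝ)| + |((rayMult j n : ℚ) : ℝ) * ((rayPClosed j n : ℚ) : ℝ)|
      ≤ exp ((growthRate j b + ε / 2) * n) + exp ((growthRate j b + ε / 2) * n) := add_le_add hQ' hP'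
    _ = exp ((growthRate j b + ε / 2) * n) * 2 := by ring
    _ ≤ exp ((growthRate j b + ε / 2) * n) * exp (ε / 2 * n) := by gcongr

/-! ### The endgame, with the growth rate as a parameter -/

/-- **RAY MEASURE from (L2) and (T-G at rate `b ≥ b_j`)**, `j ≥ 4` (integrality is fam-denom's theorem, (L4) is
`rayQxi_holds`): every `τ ∈ (h(j,b), 4W log 2)`, `τ' > 4W log 2` give `‖ξ − u/v‖₂ ≥ C · max(|u|,v)^{−τ'/(τ − h)}` with
exponent `τ'/(τ − h(j,b))`. -/
theorem ray_measure_at {j : ℕ} (hj : 4 ≤ j) (hPF : RayPF j) {b : ℝ} (hb : bRate j ≤ b) (hB : RayPGrowthAt j b)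
    {τ τ' : ℝ} (hτ1 : growthRate j b < τ) (hτ2 : τ < 4 * (2 * j + 1) * log 2)
    (hτ' : 4 * (2 * j + 1) * log 2 < τ') :
    ∃ C : ℝ, 0 < C ∧ ∀ r : ℚ,
      C * (max (r.num.natAbs : ℝ) r.den) ^ (-(τ' / (τ - growthRate j b)))
        ≤ ‖xi - ((r : ℚ) : ℚ_[2])‖ := by
  set ε : ℝ := (4 * (2 * j + 1) * log 2 - τ) / 2 with hε
  have hε0 : 0 < ε := by rw [hε]; linarith
  obtain ⟨n₀, hG⟩ := ray_sum_growth (by omega) hb hB hε0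
  have hq0 : 0 ≤ growthRate j b + ε := by
    have := rayRate_nonneg j; unfold rayRate at this; unfold growthRate; linarith
  have h1 : growthRate j b + ε < τ + ε := by linarith
  have h2 : τ + ε < 4 * (2 * j + 1) * log 2 := by rw [hε]; linarith
  obtain ⟨n₁, hmeas⟩ := ray_measure_intrinsic (by omega) (fun n => rayPClosed j n)
    (fun n hn => ray_identity_closed (by omega) hPF n hn) (fun n hn => ray_integrality_closed hj n hn)
    hG hq0 h1 h2 hτ'
  refine ⟨exp (-(τ' * (n₁ + 1))), exp_pos _, fun r => ?_⟩
  have h3 : τ + ε - (growthRate j b + ε) = τ - growthRate j b := by ring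
  have := hmeas r
  rwa [h3] at this

/-- **`ξ ∉ ℚ` from (L2) and (T-G at any admissible rate)**: `4 ≤ j`, `RayPF j`, `RayPGrowthAt j b` with
`b_j ≤ b` and `h(j, b) < 4(2j+1) log 2` give `∀ r : ℚ, ξ ≠ r`. -/
theorem xi_not_ratCast_at {j : ℕ} (hj : 4 ≤ j) (hPF : RayPF j) {b : ℝ} (hb : bRate j ≤ b)
    (hB : RayPGrowthAt j b) (hlt : growthRate j b < 4 * (2 * j + 1) * log 2) :
    ∀ r : ℚ, xi ≠ ((r : ℚ) : ℚ_[2]) := by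
  intro r hr
  obtain ⟨τ, hτ1, hτ2⟩ := exists_between hlt
  obtain ⟨C, hC, hmeas⟩ := ray_measure_at hj hPF hb hB hτ1 hτ2 (lt_add_one _)
  have h := hmeas r
  rw [hr, sub_self, norm_zero] at h
  have hH : (0 : ℝ) < max (r.num.natAbs : ℝ) r.den :=
    lt_of_lt_of_le (by exact_mod_cast r.den_pos) (le_max_right _ _)
  exact absurd h (not_le.mpr (by positivity))

/-- **`ξ ∉ ℚ` at the kernel rate**: `4 ≤ j → RayPF j → RayPGrowthAt j (bRate (j+1)) → ∀ r : ℚ, ξ ≠ r` — and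
`RayPGrowthAt j (bRate (j+1))` is fam-denom's theorem `abs_rayPClosed_eventually_le_exp` (staged), so modulo the
filing lane the ONLY remaining input is (L2), the partial-fraction identity `RayPF j` for one `j ≥ 4`. -/
theorem xi_not_ratCast_succRate {j : ℕ} (hj : 4 ≤ j) (hPF : RayPF j) (hB : RayPGrowthAt j (bRate (j + 1))) :
    ∀ r : ℚ, xi ≠ ((r : ℚ) : ℚ_[2]) :=
  xi_not_ratCast_at hj hPF (bRate_le_succ j) hB (growthRate_succ_lt j (by omega))

/-- The measure at the kernel rate: exponent `τ'/(τ − h(j, b_{j+1}))`,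
`h(j, b_{j+1}) < τ < 4(2j+1) log 2 < τ'`. -/
theorem ray_measure_succRate {j : ℕ} (hj : 4 ≤ j) (hPF : RayPF j) (hB : RayPGrowthAt j (bRate (j + 1)))
    {τ τ' : ℝ} (hτ1 : growthRate j (bRate (j + 1)) < τ) (hτ2 : τ < 4 * (2 * j + 1) * log 2)
    (hτ' : 4 * (2 * j + 1) * log 2 < τ') :
    ∃ C : ℝ, 0 < C ∧ ∀ r : ℚ,
      C * (max (r.num.natAbs : ℝ) r.den) ^ (-(τ' / (τ - growthRate j (bRate (j + 1)))))
        ≤ ‖xi - ((r : ℚ) : ℚ_[2])‖ :=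
  ray_measure_at hj hPF (bRate_le_succ j) hB hτ1 hτ2 hτ'

/-- `ξ ∉ ℚ` at the true rate `b_j` (the hypothesis `RayPGrowthAt j (bRate j)` holds but is not provable termwise). -/
theorem xi_not_ratCast_closed {j : ℕ} (hj : 4 ≤ j) (hPF : RayPF j) (hB : RayPGrowthAt j (bRate j)) :
    ∀ r : ℚ, xi ≠ ((r : ℚ) : ℚ_[2]) :=
  xi_not_ratCast_at hj hPF le_rfl hB (by rw [growthRate_bRate]; exact rayRate_lt j (by omega))

/-! ### The first admissible ray `j = 4` at `n = 1`: the first term of (L2) holds in the kernel -/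

/-- The pole data of `R_1` at `J = 4` (kernel evaluation of fam-denom's `coef`, `logDer`). -/
theorem coef_one_four_values :
    coef 1 4 0 = -35 / 256 ∧ coef 1 4 1 = -15 / 512 ∧ coef 1 4 2 = -5 / 512 ∧ coef 1 4 3 = -7 / 2048 ∧
      coef 1 4 (-1) = -315 / 512 ∧ coef 1 4 (-2) = -693 / 512 ∧ logDer 1 4 (-1) = -3139 / 1260 := by
  norm_num [coef, K0, Nnum, D1, D2, skip, logDer, prod_range_succ, sum_range_succ]

/-- **`PF 1 4` holds** (kernel): the first term of `RayPF 4`. -/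
theorem PF_one_four : PF 1 4 := by
  intro ν
  obtain ⟨c0, c1, c2, c3, cm1, cm2, ld⟩ := coef_one_four_values
  simp only [Rn, K0, Nnum, Dfull1, Dfull2, prod_range_succ, prod_range_zero, sum_range_succ, sum_range_zero,
    show (4 - 1 + 1 : ℕ) = 4 from rfl, show (2 * 1 : ℕ) = 2 from rfl, show Icc (1 : ℕ) 1 = {1} from rfl,
    show Icc (1 + 1 : ℕ) 2 = {2} from rfl, sum_singleton, Nat.cast_zero, Nat.cast_one, Nat.cast_ofNat, c0, c1,
    c2, c3]
  rw [cm1, cm2, ld]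
  generalize hx : (ν : ℚ) + 1 / 2 = x
  have hxν : x = ν + 1 / 2 := hx.symm
  have k0 : x ≠ 0 := by rw [hxν]; positivity
  have k1 : x - 1 ≠ 0 := by
    rw [hxν]; intro h
    have h' : (2 * ν : ℤ) = 1 := by exact_mod_cast (by linarith : (2 : ℚ) * ν = 1)
    omega
  have k2 : x - 2 ≠ 0 := by
    rw [hxν]; intro h
    have h' : (2 * ν : ℤ) = 3 := by exact_mod_cast (by linarith : (2 : ℚ) * ν = 3)
    omega
  have k3 : x - 3 ≠ 0 := by
    rw [hxν]; intro h
    have h' : (2 * ν : ℤ) = 5 := by exact_mod_cast (by linarith : (2 : ℚ) * ν = 5)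
    omega
  have k4 : x + 1 ≠ 0 := by rw [hxν]; positivity
  have k5 : x + 2 ≠ 0 := by rw [hxν]; positivity
  have e1 : x - 4 + 1 + 0 = x - 3 := by ring
  have e2 : x - 4 + 1 + 1 = x - 2 := by ring
  have e3 : x - 4 + 1 + 2 = x - 1 := by ring
  have e4 : x - 4 + 1 + 3 = x := by ring
  have e5 : x - 4 + 1 + 4 = x + 1 := by ring
  have e6 : x + 0 + 1 = x + 1 := by ring
  have e7 : x + 1 + 1 = x + 2 := by ring
  have e8 : x - 0 = x := by ring
  simp only [e1, e2, e3, e4, e5, e6, e7, e8, one_mul]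
  field_simp
  ring

/-- `QxiClosed 1 4 = 35205/4096` (kernel evaluation). -/
theorem QxiClosed_one_four : QxiClosed 1 4 = 35205 / 4096 := by
  norm_num [QxiClosed, coef, K0, Nnum, D1, D2, skip, Denom.CatalanRayPClosed.tB, prod_range_succ, sum_range_succ,
    Nat.choose_succ_succ, Nat.factorial, show Icc (1 : ℕ) 1 = {1} from rfl]

/-- `catalanQ(1,4,1,5,1) = 35205/4096` (kernel evaluation): the first term of `RayQxi 4`. -/
theorem catalanQ_one_four : catalanQ 1 4 1 5 1 = 35205 / 4096 := by
  decide +kernel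

/-- **Kernel instance of the 2-adic identity on the first admissible ray** (`j = 4`, `n = 1`; UNCONDITIONAL):
`J₂(1,4,1,5,1) = rayPClosed 4 1 + ξ · rayQ 4 1` in `ℚ₂` (`= −2890747/368640 + (35205/4096)·ξ`,
`Denom.CatalanRayPClosed.PClosed_one_four`). -/
theorem J2_ray_four_one :
    J2 1 (4 * 1) 1 ((4 + 1) * 1) 1 = ((rayPClosed 4 1 : ℚ) : ℚ_[2]) + xi * ((rayQ 4 1 : ℚ) : ℚ_[2]) :=
  J2_ray_eq_of_PF 4 1 PF_one_four (QxiClosed_one_four.trans catalanQ_one_four.symm)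

end Summit.KontsevichZagierPeriods.Zeta5Search.CatalanTwoAdicSeries

end
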